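import Summits.AtomisticToContinuum.FouriersLaw.Theorems.OddSectorIrreversibilityCorrectorTheoryBondSum
import Summits.AtomisticToContinuum.FouriersLaw.Theorems.OddSectorIrreversibilityCorrectorTheorySmooth
import Summits.AtomisticToContinuum.FouriersLaw.Theorems.OddSectorIrreversibilityOddDensityIsCorrectorDetailedBalance
import Literature.MathematicalPhysics.KineticTheory.ChainReflection
import HarnessLib

/-!
# `stub_anchoredKubo` of line `loomis-compact-horizon-witness`, part 2: DC-flatness
(crux `EmbeddedDrudeMourre.AbelThermodynamicLimit`, item stmt-AtomisticToContinuum-12596;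
`--supports` helper file for the registered stub S3 `stub_anchoredKubo`, closes nothing)

Kundu–Dhar–Narayan's DC-flatness (arXiv:0809.4543, (reln3)) for the pinned anharmonic chain
`pinnedChain ω₂ lam β γ` (all `> 0`) at equilibrium temperature `T > 0`, `N ≥ 1`: the static pairing
`∫ j_i u⋆ dμ_T` of the Kubo corrector `u⋆(z) = ∫_{(0,∞)} P_t J(z) dt` (`J = Σ_k j_k`, kernels
`transitionKernel N T T t`, Gibbs measure `gibbsMeasure N T`) with the bond current `j_i` is the
same for every bond `i ≤ N-2` (`integral_bondCurrent_mul_kubo_eq`), hence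
`Σ_i ∫ j_i u⋆ dμ_T = (N-1) ∫ j_c u⋆ dμ_T` (registered sub-goal `stub_anchoredKuboFlatness`). `u⋆` agrees
a.e. with the smooth classical solution `u` of `L u = -J` (`corrector_smooth`), to which the bond sum
rule `∫ u j_i e^{-H/T} = ∫ u j_{i+1} e^{-H/T}` of the corrector calculus (`bond_sum_rule_density`)
applies at every interior site. Also: pairing an odd current with a momentum-reversed observable
flips the sign (`integral_bondCurrent_mul_comp_reversal`).

Used by part 3 (`…AnchoredKubo.lean`) to turn the bond-summed Kubo pairing into the anchored one.
-/

noncomputable section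

open MeasureTheory ProbabilityTheory Filter Topology Set Function
open scoped NNReal ENNReal

namespace Summit.AtomisticToContinuum.FouriersLaw.Theorems.AbelThermodynamicLimit.LoomisCompactHorizonWitness

open Literature.MathematicalPhysics.KineticTheory.HeatConduction
open Literature.MathematicalPhysics.KineticTheory OscillatorChain
open Summit.AtomisticToContinuum.FouriersLaw.Theorems.SubdiffusiveBondHeat
open Summit.AtomisticToContinuum.FouriersLaw.Theorems.LightConeBondHeat
open Summit.AtomisticToContinuum.FouriersLaw.Theorems.OddSectorIrreversibility
open Summit.AtomisticToContinuum.FouriersLaw.Theorems.OddSectorIrreversibility.Corrector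

variable {N : ℕ}

/-! ## §3 DC-flatness: the corrector pairs identically with every bond current -/

/-- Pairing an odd bond current with a reversed observable flips the sign:
`∫ j_i(x) g(Θx) dμ_T = -∫ j_i g dμ_T`. [folklore] -/
theorem integral_bondCurrent_mul_comp_reversal (P : OscillatorChain) (N : ℕ) (T : ℝ) (i : Fin N)
    (g : PhaseSpace N → ℝ) :
    ∫ x, P.bondCurrent N i x * g (x.1, -x.2) ∂(P.gibbsMeasure N T) =
      -∫ x, P.bondCurrent N i x * g x ∂(P.gibbsMeasure N T) := by
  have h := integral_comp_reversal_gibbsMeasure P N T (fun x => P.bondCurrent N i x * g (x.1, -x.2))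
  simp only [OscillatorChain.bondCurrent_neg_momentum, neg_neg, Prod.mk.eta, neg_mul,
    integral_neg] at h
  linarith

section Flat

variable {ω₂ lam β γ : ℝ} (hω : 0 < ω₂) (hl : 0 < lam) (hβ : 0 < β) (hγ : 0 < γ) (hN : 0 < N)
  {T : ℝ} (hT : 0 < T)
include hω hl hβ hγ hN hT

/-- **DC-flatness** (Kundu–Dhar–Narayan (reln3)): the static pairing `∫ j_i u⋆ dμ_T` of the Kubo
corrector `u⋆ = ∫₀^∞ P_t J dt` with the bond current is the same for every bond `i ≤ N-2`
(`= ∫ j_0 u⋆ dμ_T`): `u⋆` agrees a.e. with the smooth classical solution `u` of `L u = -J`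
(`corrector_smooth`), for which the bond sum rule `∫ u j_i e^{-H/T} = ∫ u j_{i+1} e^{-H/T}`
holds at every interior site. [cite: KunduDharNarayan2009, eq. (reln3)] -/
theorem integral_bondCurrent_mul_kubo_eq (i : Fin N) (hi : i.val + 1 < N) :
    ∫ z, (pinnedChain ω₂ lam β γ).bondCurrent N i z *
        (∫ t in Ioi (0 : ℝ), ∫ y, (∑ k : Fin N, (pinnedChain ω₂ lam β γ).bondCurrent N k y)
          ∂((pinnedChain ω₂ lam β γ).transitionKernel N T T t.toNNReal z))
      ∂((pinnedChain ω₂ lam β γ).gibbsMeasure N T) =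
    ∫ z, (pinnedChain ω₂ lam β γ).bondCurrent N ⟨0, hN⟩ z *
        (∫ t in Ioi (0 : ℝ), ∫ y, (∑ k : Fin N, (pinnedChain ω₂ lam β γ).bondCurrent N k y)
          ∂((pinnedChain ω₂ lam β γ).transitionKernel N T T t.toNNReal z))
      ∂((pinnedChain ω₂ lam β γ).gibbsMeasure N T) := by
  set P := pinnedChain ω₂ lam β γ with hP
  set μ := P.gibbsMeasure N T with hμ
  set ρ := P.gibbsDensity N T with hρ
  set J : PhaseSpace N → ℝ := fun y => ∑ k : Fin N, P.bondCurrent N k y with hJ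
  obtain ⟨hϑ0, h2ϑ⟩ := quarter_inv_temp_admissible hT
  have hϑ1 : 1 / (4 * T) < 1 / T := by linarith
  obtain ⟨u, hus, hae, hpde, hbd⟩ := corrector_smooth hω hl hβ hγ hT hN
  obtain ⟨K, hK, huK⟩ := hbd _ hϑ0 hϑ1
  have huc : Continuous u := hus.continuous
  have hu2 : MemLp u 2 μ := memLp_two_of_abs_le_exp hω hl.le hβ.le hT γ huc h2ϑ huK
  obtain ⟨M, hM, hJM⟩ := abs_totalBondCurrent_le_exp hω.le hl.le hβ.le γ N hϑ0
  have hJc : Continuous J := continuous_totalBondCurrent ω₂ lam β γ N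
  have hJ2 : MemLp J 2 μ := memLp_two_of_abs_le_exp hω hl.le hβ.le hT γ hJc h2ϑ hJM
  have hJodd : ∀ x : PhaseSpace N, J (x.1, -x.2) = -J x := totalBondCurrent_neg_momentum P N
  -- `u⋆ = u` `μ_T`-a.e.
  have haeμ := (P.gibbsMeasure_absolutelyContinuous N T).ae_eq hae
  have hred : ∀ k : Fin N, ∫ z, P.bondCurrent N k z * (∫ t in Ioi (0 : ℝ), ∫ y, J y
      ∂(P.transitionKernel N T T t.toNNReal z)) ∂μ = (∫ x, ρ x)⁻¹ * ∫ x, u x * P.bondCurrent N k x * ρ x := by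
    intro k
    rw [← P.integral_gibbsMeasure]
    refine integral_congr_ae ?_
    filter_upwards [haeμ] with z hz
    rw [hz, mul_comm]
  -- the bond sum rule, iterated down to bond `0`
  have hflat : ∀ (m : ℕ) (hm : m + 1 < N),
      ∫ x, u x * P.bondCurrent N ⟨m, by omega⟩ x * ρ x = ∫ x, u x * P.bondCurrent N ⟨0, hN⟩ x * ρ x := by
    intro m
    induction m with
    | zero => intro hm; rfl
    | succ m ih =>
        intro hm
        have h := bond_sum_rule_density hω hl.le hβ.le hT hγ (hus.of_le (by norm_cast)) hu2 hJc hJ2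
          hJodd hpde (i := ⟨m, by omega⟩) (i' := ⟨m + 1, hm.le.trans_lt' (by omega)⟩) rfl hm
        rw [← ih (by omega)]
        exact h.symm
  obtain ⟨m, hm⟩ := i
  rw [hred, hred, hflat m hi]


end Flat

/-- **Registered sub-goal `stub_anchoredKuboFlatness` — summing the flat pairings**: for
`P = pinnedChain ω₂ lam β γ` (all `> 0`), `T > 0` and every bond `c ≤ N-2`,
`Σ_i ∫ j_i u⋆ dμ_T = (N-1) ∫ j_c u⋆ dμ_T`, `u⋆ = ∫_{(0,∞)} P_t J dt` the Kubo corrector of the total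
current (DC-flatness `integral_bondCurrent_mul_kubo_eq`; the last index carries no bond).
[cite: KunduDharNarayan2009, eq. (reln3)] -/
theorem stub_anchoredKuboFlatness :
    ∀ ω₂ lam β γ : ℝ, 0 < ω₂ → 0 < lam → 0 < β → 0 < γ → ∀ T : ℝ, 0 < T →
      ∀ (N : ℕ) (c : Fin N), c.val + 1 < N →
        ∑ i : Fin N, ∫ z, (Literature.MathematicalPhysics.KineticTheory.HeatConduction.pinnedChain ω₂ lam β γ).bondCurrent N i z *
            (∫ t in Set.Ioi (0 : ℝ), ∫ y, (∑ k : Fin N, (Literature.MathematicalPhysics.KineticTheory.HeatConduction.pinnedChain ω₂ lam β γ).bondCurrent N k y)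
              ∂((Literature.MathematicalPhysics.KineticTheory.HeatConduction.pinnedChain ω₂ lam β γ).transitionKernel N T T t.toNNReal z))
          ∂((Literature.MathematicalPhysics.KineticTheory.HeatConduction.pinnedChain ω₂ lam β γ).gibbsMeasure N T) =
        ((N : ℝ) - 1) * ∫ z, (Literature.MathematicalPhysics.KineticTheory.HeatConduction.pinnedChain ω₂ lam β γ).bondCurrent N c z *
            (∫ t in Set.Ioi (0 : ℝ), ∫ y, (∑ k : Fin N, (Literature.MathematicalPhysics.KineticTheory.HeatConduction.pinnedChain ω₂ lam β γ).bondCurrent N k y)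
              ∂((Literature.MathematicalPhysics.KineticTheory.HeatConduction.pinnedChain ω₂ lam β γ).transitionKernel N T T t.toNNReal z))
          ∂((Literature.MathematicalPhysics.KineticTheory.HeatConduction.pinnedChain ω₂ lam β γ).gibbsMeasure N T) := by
  intro ω₂ lam β γ hω hl hβ hγ T hT N c hc
  have hN : 0 < N := by omega
  have h0 := integral_bondCurrent_mul_kubo_eq hω hl hβ hγ hN hT
  rw [h0 c hc]
  obtain ⟨n, hn⟩ : ∃ n, N = n + 1 := ⟨N - 1, by omega⟩
  subst hn
  rw [Fin.sum_univ_castSucc]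
  have hlast : ∫ z, (pinnedChain ω₂ lam β γ).bondCurrent (n + 1) (Fin.last n) z *
        (∫ t in Ioi (0 : ℝ), ∫ y, (∑ k : Fin (n + 1), (pinnedChain ω₂ lam β γ).bondCurrent (n + 1) k y)
          ∂((pinnedChain ω₂ lam β γ).transitionKernel (n + 1) T T t.toNNReal z))
      ∂((pinnedChain ω₂ lam β γ).gibbsMeasure (n + 1) T) = 0 := by
    simp [OscillatorChain.bondCurrent_eq_zero_of_last _ (n + 1) (Fin.last n) (by simp)]
  rw [hlast, add_zero]
  rw [Finset.sum_congr rfl fun (i : Fin n) _ => h0 i.castSucc (by simp [Fin.val_castSucc])]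
  rw [Finset.sum_const, Finset.card_univ, Fintype.card_fin, nsmul_eq_mul]
  push_cast
  ring_nf

end Summit.AtomisticToContinuum.FouriersLaw.Theorems.AbelThermodynamicLimit.LoomisCompactHorizonWitness

end
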